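import Literature.NumberTheory.LFunctions.XiHorizontalLogDeriv
import Literature.NumberTheory.LFunctions.ZetaFractionalPartIntegral
import Literature.NumberTheory.LFunctions.PrimeLogSeries
import HarnessLib

/-!
# `ξ` across the critical strip at large height, against its value at abscissa `σ + 5`

Trunk T-ANT (`Literature/NumberTheory/LFunctions`). Everything here is proved (no named facts).
Third file of the in-tree proof of `Literature.NumberTheory.LFunctions.ki_kim_lee_finite` (Ki–Kim–Lee 2009, Thm. 1.3). In the
Laplace analysis of `𝒜_t(σ + iT) = ∫_0^∞ e^{-u²/t} ξ(σ + u + iT) du` (`XiHeatRayLaplace.lean`) the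
initial segment `0 ≤ u ≤ 5` of the ray, where `σ + u` crosses the critical strip, is treated
crudely: all that is needed is that `|ξ(x + iT)|` for `0 ≤ x ≤ 6` is at most polynomially (in `T`)
larger than `|ξ(σ + 5 + iT)|`. This follows from `ξ = ½ w(w−1) π^{-w/2} Γ(w/2) ζ(w)`: `|Γ(w/2)|`
is non-decreasing in `Re w` at height `T ≥ 6` (`Re ψ ≥ 0` there, by the first-quadrant Stirling
bound `Literature.Analysis.SpecialFunctions.Complex.log_norm_sub_le_re_digamma`), `|ζ(x + iT)| ≤ 2T + 14` for `x ≥ 1/2`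
(Titchmarsh (2.12.2), `Literature.NumberTheory.LFunctions.norm_riemannZeta_le_of_re_pos`), `|ζ| ≥ 1/3` on `Re ≥ 2`, and the
functional equation handles `0 ≤ x < 1/2`.

## Main results

* `Literature.NumberTheory.LFunctions.re_digamma_nonneg` — `Re ψ(z) ≥ 0` for `Re z > 0`, `Im z ≥ 3`.
* `Literature.NumberTheory.LFunctions.norm_Gamma_le_norm_Gamma_add_real` — `|Γ(z)| ≤ |Γ(z + d)|` for real `d ≥ 0`, `Re z > 0`,
  `Im z ≥ 3`.
* `Literature.NumberTheory.LFunctions.norm_riemannXi_strip_le` — for `T ≥ 14`, `1/2 ≤ x ≤ x₅ ∈ [5, 6]`: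
  `|ξ(x + iT)| ≤ 100 (2T + 14) |ξ(x₅ + iT)|`.
* `Literature.NumberTheory.LFunctions.norm_riemannXi_le_of_re_le_six` — for `T ≥ 100`, `σ ∈ [0,1]`, `x ∈ [0, 6]`:
  `|ξ(x + iT)| ≤ 300 T |ξ(σ + 5 + iT)|`.

## References

* E. C. Titchmarsh, *The Theory of the Riemann Zeta-Function*, 2nd ed., §2.12 eq. (2.12.2), §4.12.
* D. H. J. Polymath, Res. Math. Sci. 6 (2019) 31, §9 (where the corresponding crude bounds are
  eq. (9.4)–(9.6)).
-/

noncomputable section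

open Complex Filter Topology Set MeasureTheory intervalIntegral
open scoped Real

namespace Literature.NumberTheory.LFunctions

/-! ## `|Γ|` is non-decreasing in the real part at height `≥ 3` -/

/-- `Re ψ(z) ≥ 0` for `Re z > 0`, `Im z ≥ 3` (`Re ψ(z) ≥ log‖z‖ − 1/(2‖z‖²) − π/(4 Im z)` and
`log 3 > 1`). [folklore] -/
theorem re_digamma_nonneg {z : ℂ} (hre : 0 < z.re) (him : 3 ≤ z.im) : 0 ≤ (digamma z).re := by
  have hy : z.im ≠ 0 := by intro h; rw [h] at him; norm_num at him
  have h := Literature.Analysis.SpecialFunctions.Complex.log_norm_sub_le_re_digamma hre hy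
  have hz : 3 ≤ ‖z‖ := him.trans ((le_abs_self _).trans (Complex.abs_im_le_norm z))
  have hz0 : 0 < ‖z‖ := by linarith
  have hlog : 1 ≤ Real.log ‖z‖ := by
    rw [Real.le_log_iff_exp_le hz0]
    have := Real.exp_one_lt_d9; linarith
  have h1 : 1 / (2 * ‖z‖ ^ 2) ≤ 1 / 18 := by
    apply div_le_div_of_nonneg_left (by norm_num) (by norm_num); nlinarith
  have h2 : π / (4 * |z.im|) ≤ π / 12 := by
    rw [abs_of_pos (by linarith)]
    apply div_le_div_of_nonneg_left Real.pi_pos.le (by norm_num); linarith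
  linarith [Real.pi_lt_d2]

/-- **`|Γ(z)| ≤ |Γ(z + d)|` for real `d ≥ 0`, `Re z > 0`, `Im z ≥ 3`**
(`Γ(z+d) = Γ(z) exp(∫_{[z, z+d]} ψ)` and `Re ψ ≥ 0` on the segment). [cite: Titchmarsh1986, §4.12] -/
theorem norm_Gamma_le_norm_Gamma_add_real {z₀ : ℂ} {d : ℝ} (hre : 0 < z₀.re) (him : 3 ≤ z₀.im)
    (hd : 0 ≤ d) : ‖Gamma z₀‖ ≤ ‖Gamma (z₀ + d)‖ := by
  have h0 : 0 < z₀.im := by linarith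
  have h1 : 0 < (z₀ + d).im := by simpa using h0
  rw [Literature.Analysis.SpecialFunctions.Complex.Gamma_eq_mul_exp_integral_digamma h0 h1, norm_mul, Complex.norm_exp,
    add_sub_cancel_left]
  have hcont : Continuous fun τ : ℝ ↦ digamma (z₀ + τ * (d : ℂ)) * (d : ℂ) := by
    refine Continuous.mul ?_ continuous_const
    refine Literature.Analysis.SpecialFunctions.Complex.differentiableOn_digamma_im_pos.continuousOn.comp_continuous
      (by fun_prop) fun τ ↦ ?_
    show 0 < (z₀ + τ * (d : ℂ)).im
    simpa using h0
  have hre_int : (∫ τ in (0:ℝ)..1, digamma (z₀ + τ * (d : ℂ)) * (d : ℂ)).re =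
      ∫ τ in (0:ℝ)..1, (digamma (z₀ + τ * (d : ℂ)) * (d : ℂ)).re := by
    have := intervalIntegral_re (hcont.intervalIntegrable (μ := volume) 0 1)
    simpa using this.symm
  have hnonneg : 0 ≤ (∫ τ in (0:ℝ)..1, digamma (z₀ + τ * (d : ℂ)) * (d : ℂ)).re := by
    rw [hre_int]
    refine intervalIntegral.integral_nonneg zero_le_one fun τ hτ ↦ ?_
    rw [mul_re, ofReal_re, ofReal_im, mul_zero, sub_zero]
    refine mul_nonneg (re_digamma_nonneg ?_ ?_) hd
    · simp only [add_re, mul_re, ofReal_re, ofReal_im, mul_zero, sub_zero]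
      nlinarith [hτ.1]
    · simpa using him
  calc ‖Gamma z₀‖ = ‖Gamma z₀‖ * Real.exp 0 := by simp
    _ ≤ ‖Gamma z₀‖ * Real.exp ((∫ τ in (0:ℝ)..1, digamma (z₀ + τ * (d : ℂ)) * (d : ℂ)).re) := by
        gcongr

/-! ## `ξ` on `1/2 ≤ Re w ≤ 6` against `ξ` at abscissa `x₅ ∈ [5, 6]` -/

/-- `‖x + iT‖ ≤ ‖x' + iT‖` whenever `|x| ≤ |x'|`. [folklore] -/
theorem norm_add_mul_I_le_of_abs_le {x x' T : ℝ} (h : |x| ≤ |x'|) :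
    ‖(x : ℂ) + T * I‖ ≤ ‖(x' : ℂ) + T * I‖ := by
  rw [Complex.norm_add_mul_I, Complex.norm_add_mul_I]
  apply Real.sqrt_le_sqrt
  nlinarith [sq_abs x, sq_abs x', abs_nonneg x, abs_nonneg x']

/-- `T ≤ ‖x + iT‖` for `T ≥ 0`. [folklore] -/
theorem le_norm_add_mul_I (x : ℝ) {T : ℝ} (hT : 0 ≤ T) : T ≤ ‖(x : ℂ) + T * I‖ := by
  have h := Complex.abs_im_le_norm ((x : ℂ) + T * I)
  simp only [add_im, ofReal_im, mul_im, ofReal_re, I_im, mul_one, I_re, mul_zero, add_zero,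
    zero_add] at h
  rwa [abs_of_nonneg hT] at h

/-- `‖x + iT‖ ≤ |x| + |T|`. [folklore] -/
theorem norm_add_mul_I_le (x T : ℝ) : ‖(x : ℂ) + T * I‖ ≤ |x| + |T| := by
  calc ‖(x : ℂ) + T * I‖ ≤ ‖(x : ℂ)‖ + ‖(T : ℂ) * I‖ := norm_add_le _ _
    _ = |x| + |T| := by simp

/-- **`|ζ(x + iT)| ≤ 2T + 14` for `x ≥ 1/2`, `|x| ≤ 6`, `T ≥ 6`** (Titchmarsh (2.12.2):
`|ζ(s)| ≤ |s|/|s−1| + |s|/σ`). [cite: Titchmarsh1986, §2.12 eq. (2.12.2)] -/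
theorem norm_riemannZeta_le_height {x T : ℝ} (hx : 1 / 2 ≤ x) (hx6 : x ≤ 6) (hT : 6 ≤ T) :
    ‖riemannZeta ((x : ℂ) + T * I)‖ ≤ 2 * T + 14 := by
  set w : ℂ := (x : ℂ) + T * I with hw
  have hwre : w.re = x := by simp [hw]
  have hw0 : 0 < w.re := by rw [hwre]; linarith
  have hw1 : w ≠ 1 := by
    intro h; have := congrArg Complex.im h; simp [hw] at this; linarith
  have h := LFunctions.norm_riemannZeta_le_of_re_pos hw0 hw1
  have hnw : ‖w‖ ≤ T + 6 := by
    have := norm_add_mul_I_le x T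
    rw [abs_of_nonneg (by linarith : (0:ℝ) ≤ x), abs_of_nonneg (by linarith : (0:ℝ) ≤ T)] at this
    simp only [hw]; linarith
  have hnw1 : T ≤ ‖w - 1‖ := by
    have : w - 1 = ((x - 1 : ℝ) : ℂ) + T * I := by simp [hw]; ring
    rw [this]; exact le_norm_add_mul_I _ (by linarith)
  have hT0 : 0 < T := by linarith
  have hA : ‖w‖ / ‖w - 1‖ ≤ 2 := by
    rw [div_le_iff₀ (by linarith)]; nlinarith
  have hB : ‖w‖ / w.re ≤ 2 * T + 12 := by
    rw [hwre, div_le_iff₀ (by linarith)]; nlinarith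
  linarith

/-- **`|ζ(w)| ≥ 1/3` for `Re w ≥ 2`** (`|ζ(w) − 1| ≤ ζ(2) − 1 = π²/6 − 1 < 2/3`).
[cite: Titchmarsh1986, §2.12] -/
theorem one_third_le_norm_riemannZeta {w : ℂ} (hw : 2 ≤ w.re) : 1 / 3 ≤ ‖riemannZeta w‖ := by
  have h := Nicolas.norm_riemannZeta_sub_one_le hw
  have hπ : π ^ 2 / 6 - 1 ≤ 2 / 3 := by
    have := Real.pi_lt_d2; nlinarith [Real.pi_pos]
  have h1 : ‖(1 : ℂ)‖ - ‖riemannZeta w - 1‖ ≤ ‖riemannZeta w‖ := by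
    have := norm_sub_norm_le (1 : ℂ) (1 - riemannZeta w)
    rw [sub_sub_cancel, norm_sub_rev] at this
    linarith
  rw [norm_one] at h1
  linarith

/-- The norm of the five factors of `ξ(w) = (w/2) π^{-w/2} Γ(w/2) (w − 1) ζ(w)` for `Re w > 0`,
`w ≠ 1`. [cite: Titchmarsh1986, §2.1 eq. (2.1.12)] -/
theorem norm_riemannXi_eq_prod {w : ℂ} (hw0 : 0 < w.re) (hw1 : w ≠ 1) :
    ‖riemannXi w‖ = ‖w‖ / 2 * (π ^ (-w.re / 2) * ‖Gamma (w / 2)‖) * (‖w - 1‖ * ‖riemannZeta w‖) := by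
  rw [riemannXi_eq_mul_of_re_pos hw0, LFunctions.riemannZeta₁_eq_mul hw1, Gammaℝ_def, norm_mul, norm_mul,
    norm_mul, norm_mul, norm_div, Complex.norm_two,
    Complex.norm_cpow_eq_rpow_re_of_pos Real.pi_pos]
  congr 2
  simp [neg_div]

/-- **`ξ` in the right half of the strip (and beyond) against abscissa `x₅`**: for `T ≥ 14`,
`1/2 ≤ x ≤ x₅`, `5 ≤ x₅ ≤ 6`: `|ξ(x + iT)| ≤ 100 (2T + 14) |ξ(x₅ + iT)|`
(`|w| ≤ |w₅|`, `|w − 1| ≤ |w₅ − 1|`, `π^{-x/2} ≤ π³ π^{-x₅/2}`, `|Γ(w/2)| ≤ |Γ(w₅/2)|`,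
`|ζ(w)| ≤ 2T + 14 ≤ 3 (2T + 14) |ζ(w₅)|`). [cite: Titchmarsh1986, §2.12, §4.12] -/
theorem norm_riemannXi_strip_le {T x x₅ : ℝ} (hT : 14 ≤ T) (hx : 1 / 2 ≤ x) (hxx₅ : x ≤ x₅)
    (h5 : 5 ≤ x₅) (h6 : x₅ ≤ 6) :
    ‖riemannXi ((x : ℂ) + T * I)‖ ≤ 100 * (2 * T + 14) * ‖riemannXi ((x₅ : ℂ) + T * I)‖ := by
  have hT0 : 0 < T := by linarith
  set w : ℂ := (x : ℂ) + T * I with hw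
  set w₅ : ℂ := (x₅ : ℂ) + T * I with hw₅
  have hwre : w.re = x := by simp [hw]
  have hw₅re : w₅.re = x₅ := by simp [hw₅]
  have hw0 : 0 < w.re := by rw [hwre]; linarith
  have hw₅0 : 0 < w₅.re := by rw [hw₅re]; linarith
  have hw1 : w ≠ 1 := by
    intro h; have := congrArg Complex.im h; simp [hw] at this; linarith
  have hw₅1 : w₅ ≠ 1 := by
    intro h; have := congrArg Complex.im h; simp [hw₅] at this; linarith
  rw [norm_riemannXi_eq_prod hw0 hw1, norm_riemannXi_eq_prod hw₅0 hw₅1, hwre, hw₅re]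
  -- the five comparisons
  have hA : ‖w‖ ≤ ‖w₅‖ := norm_add_mul_I_le_of_abs_le (by
    rw [abs_of_nonneg (by linarith : (0:ℝ) ≤ x), abs_of_nonneg (by linarith : (0:ℝ) ≤ x₅)]
    exact hxx₅)
  have hD : ‖w - 1‖ ≤ ‖w₅ - 1‖ := by
    have e1 : w - 1 = ((x - 1 : ℝ) : ℂ) + T * I := by simp [hw]; ring
    have e2 : w₅ - 1 = ((x₅ - 1 : ℝ) : ℂ) + T * I := by simp [hw₅]; ring
    rw [e1, e2]
    refine norm_add_mul_I_le_of_abs_le ?_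
    rw [abs_of_nonneg (by linarith : (0:ℝ) ≤ x₅ - 1), abs_le]
    constructor <;> linarith
  have hB : π ^ (-x / 2) ≤ π ^ (3 : ℝ) * π ^ (-x₅ / 2) := by
    rw [← Real.rpow_add Real.pi_pos]
    have hπ1 : (1 : ℝ) ≤ π := by linarith [Real.pi_gt_three]
    calc π ^ (-x / 2) ≤ π ^ (0 : ℝ) := Real.rpow_le_rpow_of_exponent_le hπ1 (by linarith)
      _ ≤ π ^ (3 + -x₅ / 2) := Real.rpow_le_rpow_of_exponent_le hπ1 (by linarith)
  have hC : ‖Gamma (w / 2)‖ ≤ ‖Gamma (w₅ / 2)‖ := by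
    have e : w₅ / 2 = w / 2 + (((x₅ - x) / 2 : ℝ) : ℂ) := by
      simp [hw, hw₅]; ring
    rw [e]
    refine norm_Gamma_le_norm_Gamma_add_real ?_ ?_ (by linarith)
    · simp [hw]; linarith
    · simp [hw]; linarith
  have hE : ‖riemannZeta w‖ ≤ 3 * (2 * T + 14) * ‖riemannZeta w₅‖ := by
    have h1 : ‖riemannZeta w‖ ≤ 2 * T + 14 := norm_riemannZeta_le_height hx (by linarith) (by linarith)
    have h2 : 1 / 3 ≤ ‖riemannZeta w₅‖ := one_third_le_norm_riemannZeta (by rw [hw₅re]; linarith)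
    nlinarith
  -- positivity of the `w₅` factors
  have hπx₅ : 0 < π ^ (-x₅ / 2) := Real.rpow_pos_of_pos Real.pi_pos _
  have hπ3 : π ^ (3 : ℝ) ≤ 32 := by
    rw [show (3 : ℝ) = ((3 : ℕ) : ℝ) by norm_num, Real.rpow_natCast]
    have h := pow_le_pow_left₀ Real.pi_pos.le Real.pi_lt_d2.le 3
    norm_num at h ⊢
    linarith
  calc ‖w‖ / 2 * (π ^ (-x / 2) * ‖Gamma (w / 2)‖) * (‖w - 1‖ * ‖riemannZeta w‖)
      ≤ ‖w₅‖ / 2 * (π ^ (3 : ℝ) * π ^ (-x₅ / 2) * ‖Gamma (w₅ / 2)‖) *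
        (‖w₅ - 1‖ * (3 * (2 * T + 14) * ‖riemannZeta w₅‖)) := by
        gcongr
    _ = (3 * π ^ (3 : ℝ)) * (2 * T + 14) *
        (‖w₅‖ / 2 * (π ^ (-x₅ / 2) * ‖Gamma (w₅ / 2)‖) * (‖w₅ - 1‖ * ‖riemannZeta w₅‖)) := by ring
    _ ≤ 100 * (2 * T + 14) *
        (‖w₅‖ / 2 * (π ^ (-x₅ / 2) * ‖Gamma (w₅ / 2)‖) * (‖w₅ - 1‖ * ‖riemannZeta w₅‖)) := by
        gcongr
        linarith

/-- `|ξ(x + iT)| = |ξ((1 − x) + iT)|` (functional equation and conjugation). [folklore] -/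
theorem norm_riemannXi_reflect (x T : ℝ) :
    ‖riemannXi ((x : ℂ) + T * I)‖ = ‖riemannXi (((1 - x : ℝ) : ℂ) + T * I)‖ := by
  have : (x : ℂ) + T * I = 1 - (starRingEnd ℂ) (((1 - x : ℝ) : ℂ) + T * I) := by
    apply Complex.ext <;> simp
  rw [this, riemannXi_one_sub, riemannXi_conj_holds, Complex.norm_conj]

/-- **`ξ` on `0 ≤ Re w ≤ 6` at height `T ≥ 100` against abscissa `σ + 5`**: for `σ ∈ [0, 1]` and
`x ∈ [0, 6]`, `|ξ(x + iT)| ≤ 300 T |ξ(σ + 5 + iT)|` (for `x < 1/2` reflect; for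
`1/2 ≤ x ≤ σ + 5` use `norm_riemannXi_strip_le`; for `σ + 5 < x ≤ 6` the two-point bound
`Literature.NumberTheory.LFunctions.norm_riemannXi_horizontal_le`, `e^{ℓ + 1} ≤ eT`). [cite: Polymath2019, §9] -/
theorem norm_riemannXi_le_of_re_le_six {T σ x : ℝ} (hT : 100 ≤ T) (hσ : σ ∈ Icc (0:ℝ) 1)
    (hx : x ∈ Icc (0:ℝ) 6) :
    ‖riemannXi ((x : ℂ) + T * I)‖ ≤ 300 * T * ‖riemannXi (((σ + 5 : ℝ) : ℂ) + T * I)‖ := by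
  obtain ⟨hσ0, hσ1⟩ := hσ
  obtain ⟨hx0, hx6⟩ := hx
  have hT0 : 0 < T := by linarith
  have hξ0 : 0 ≤ ‖riemannXi (((σ + 5 : ℝ) : ℂ) + T * I)‖ := norm_nonneg _
  -- the strip case, for any `x' ∈ [1/2, σ + 5]`
  have strip : ∀ x' : ℝ, 1 / 2 ≤ x' → x' ≤ σ + 5 →
      ‖riemannXi ((x' : ℂ) + T * I)‖ ≤ 300 * T * ‖riemannXi (((σ + 5 : ℝ) : ℂ) + T * I)‖ := by
    intro x' h1 h2
    refine (norm_riemannXi_strip_le (by linarith) h1 h2 (by linarith) (by linarith)).trans ?_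
    exact mul_le_mul_of_nonneg_right (by linarith) hξ0
  rcases lt_or_ge x (1 / 2) with hlt | hge
  · rw [norm_riemannXi_reflect]
    exact strip (1 - x) (by linarith) (by linarith)
  rcases le_or_gt x (σ + 5) with hle | hgt
  · exact strip x hge hle
  · -- beyond `σ + 5`: the two-point bound on the ray
    set a : ℝ := x - (σ + 5) with ha
    have ha0 : 0 ≤ a := by linarith
    have ha1 : a ≤ 1 := by linarith
    have h := norm_riemannXi_horizontal_le (T := T) (v₀ := σ + 5) (a := a) (by linarith) (by linarith) ha0
    have e : σ + 5 + a = x := by rw [ha]; ring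
    rw [e] at h
    refine h.trans ?_
    rw [mul_comm]
    gcongr
    -- `exp(ℓ a + a (η + x/(2T))) ≤ 300 T`
    have hη : xiRayErr T + x / (2 * T) ≤ 1 := by
      rw [xiRayErr]
      have h1 : 4 / T ≤ 4 / 100 := div_le_div_of_nonneg_left (by norm_num) (by norm_num) hT
      have h2 : x / (2 * T) ≤ 6 / (2 * T) := div_le_div_of_nonneg_right hx6 (by positivity)
      have h3 : 6 / (2 * T) ≤ 6 / (2 * 100) :=
        div_le_div_of_nonneg_left (by norm_num) (by norm_num) (by linarith)
      linarith
    have hℓ0 : 0 ≤ Real.log (T / (2 * π)) / 2 := by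
      have : 1 ≤ T / (2 * π) := by
        rw [le_div_iff₀ (by positivity)]; linarith [Real.pi_lt_d2]
      have := Real.log_nonneg this
      linarith
    have hℓ : Real.log (T / (2 * π)) / 2 ≤ Real.log T := by
      have h1 : Real.log (T / (2 * π)) ≤ Real.log T := by
        apply Real.log_le_log (by positivity)
        rw [div_le_iff₀ (by positivity)]; nlinarith [Real.pi_gt_three]
      have h2 : 0 ≤ Real.log T := Real.log_nonneg (by linarith)
      linarith
    have hexp : Real.log (T / (2 * π)) / 2 * a + a * (xiRayErr T + x / (2 * T)) ≤ Real.log T + 1 := by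
      have h1 : Real.log (T / (2 * π)) / 2 * a ≤ Real.log T * 1 := by
        calc Real.log (T / (2 * π)) / 2 * a ≤ Real.log (T / (2 * π)) / 2 * 1 := by gcongr
          _ ≤ Real.log T * 1 := by linarith
      have h2 : a * (xiRayErr T + x / (2 * T)) ≤ 1 * 1 :=
        mul_le_mul ha1 hη (by
          have := xiRayErr_nonneg hT0; positivity) zero_le_one
      linarith
    calc Real.exp (Real.log (T / (2 * π)) / 2 * a + a * (xiRayErr T + x / (2 * T)))
        ≤ Real.exp (Real.log T + 1) := Real.exp_le_exp.2 hexp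
      _ = T * Real.exp 1 := by rw [Real.exp_add, Real.exp_log hT0]
      _ ≤ T * 3 := by gcongr; linarith [Real.exp_one_lt_d9]
      _ ≤ 300 * T := by linarith

end Literature.NumberTheory.LFunctions

end
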